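import Literature.Probability.LatticeModels.PlanarIsingRationalSlit
import HarnessLib

/-!
# The axis-slit disc is approximated by its discretisations; `tendsto_chiPlusCorr` contradicts CHI

`PlanarIsingRationalSlit.lean` reduces the refutation of
`Literature.Probability.LatticeModels.tendsto_chiPlusCorr` relative to CHI Thm 1.3 (`k = 0`) + Wu
(`chi_onePoint_rho`, `wu_rhoCHI`) to CHI's standing approximation hypothesis for one explicit domain:
`MeshApproximates Ω_A` for the axis-slit disc `Ω_A = 𝔻 ∖ ([1/4, 1) × {0})` (written out as
`Metric.ball 0 1 ∖ {z | z.im = 0 ∧ 1/4 ≤ z.re}`; as in that file no definition and no notation is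
introduced). This file proves that hypothesis (`AxisSlitDisc.meshApproximates_domain`) and concludes

* `AxisSlitDisc.not_tendsto_chiPlusCorr_of_chi : chi_onePoint_rho → wu_rhoCHI → ¬ tendsto_chiPlusCorr`.

So `tendsto_chiPlusCorr` — CHI Thm 1.1 transcribed for the tree's *fixed* discretisation scheme but
without CHI's hypothesis that the discrete domains approximate `Ω` (arXiv:1202.2838 §1.1, §2.6) — is
refuted conditionally on CHI's own theorem, exactly like its siblings `chi_conformal_invariance` and
`isConformallyCovariant_chiPlusCorr` (`PlanarIsingCovarianceVanishing.lean`); the CHI-faithful form is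
`tendsto_chiPlusCorr_of_hausdorff` (`PlanarIsingOnePoint.lean`).

## The argument (elementary lattice geometry, [folklore]; compare `PlanarIsingDiscApprox.lean`)

Fix `0 < δ` small. The axis slit is visible to `δℤ²` at every mesh: a site `x` lies on it iff
`x₁ = 0` and `δ x₀ ≥ 1/4`.
* Sites (`mem_meshVertices_iff`, `meshDomain_eq`, `mem_meshInteriorFinset_iff`, `free_iff`): the mesh
  graph of `Ω_A` is that of `𝔻` (same closure), the mesh vertices are the disc sites off the slit, they
  are connected (walk horizontally to the imaginary axis, then vertically to `0`), so `(Ω_A)_δ` is all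
  of them, and a site is free (carries an unfrozen spin) iff it is free for the disc and neither it nor a
  neighbour lies on the slit.
* `free_shrink`: for `δ < 1/4` the free sites of a row are closed under moving the column index
  towards `0`; hence (`biUnion_mem_of_between`) horizontal sections of the union `U_δ` of the closed
  cells of the free sites are intervals, and (`shrink_mem_polygon`) the polygonal domain
  `P_δ = meshInteriorPolygon Ω_A δ = interior U_δ` is closed under `(x, y) ↦ (a x, y)`, `a ∈ [0, 1]`.
  On the imaginary axis `P_δ` agrees with the disc polygon (`mem_polygon_iff_of_re_lt`), which is
  star-shaped about `0`; the two-stage contraction "squash horizontally onto the imaginary axis, then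
  radially to `0`" shows that `P_δ` is contractible, hence simply connected
  (`isSimplyConnected_of_shrink`, `isSimplyConnected_polygon`). (It is *not* star-shaped: the removed
  channel along the slit is crossed twice by rays from any centre.)
* Metric control: `P_δ ⊆ Ω_A`; every `z` with `‖z‖ + 5δ/2 ≤ 1` which is `5δ/2`-far from the slit
  (`|Im z| > 5δ/2` or `Re z + 5δ/2 < 1/4`) lies in `P_δ` (`mem_polygon_of_far`); so `∂P_δ` is within `5δ`
  of `∂Ω_A = ∂𝔻 ∪ ([1/4, 1] × {0})`, every point of `∂Ω_A` is within `9δ` of a point of `P_δ` and hence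
  (segment argument) of `∂P_δ`: `hausdorffDist (∂P_δ) (∂Ω_A) ≤ 9δ → 0`; and every compact `K ⊆ Ω_A` is
  eventually inside `P_δ`.

## References

* D. Chelkak, C. Hongler, K. Izyurov, *Conformal invariance of spin correlations in the planar
  Ising model*, Ann. of Math. (2) 181 (2015), 1087–1138; arXiv:1202.2838, §1.1, §2.1 (discrete
  domains as unions of faces; simply connected polygonal domain), §2.6 (Hausdorff approximation),
  Thms 1.1, 1.3, Rem. 1.2 (iii).
-/

noncomputable section

open scoped Pointwise
open Filter Metric Set Complex
open _root_.Topology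
open Literature.Probability.LatticeModels

namespace Literature.Probability.LatticeModels

namespace AxisSlitDisc

variable {δ : ℝ}

/-! ### Sites of the axis-slit disc -/

/-- A mesh point lies on the axis slit iff its row index vanishes and `δ x₀ ≥ 1/4`. [folklore] -/
theorem meshPoint_mem_slit_iff (hδ : 0 < δ) (v : Site 2) :
    meshPoint δ v ∈ {z : ℂ | z.im = 0 ∧ 1 / 4 ≤ z.re} ↔ v 1 = 0 ∧ 1 / 4 ≤ δ * v 0 := by
  simp only [Set.mem_setOf_eq, meshPoint_re, meshPoint_im, mul_eq_zero, hδ.ne', false_or,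
    Int.cast_eq_zero]

/-- The mesh vertices of the axis-slit disc: disc sites off the slit. [folklore] -/
theorem mem_meshVertices_iff (hδ : 0 < δ) {v : Site 2} :
    v ∈ meshVertices (Metric.ball (0 : ℂ) 1 \ {z : ℂ | z.im = 0 ∧ 1 / 4 ≤ z.re}) δ ↔ ‖meshPoint δ v‖ < 1 ∧ ¬ (v 1 = 0 ∧ 1 / 4 ≤ δ * v 0) := by
  rw [Literature.Probability.LatticeModels.mem_meshVertices_iff, Set.mem_sdiff, mem_ball_zero_iff,
    meshPoint_mem_slit_iff hδ]

/-- A column on the slit is positive. [folklore] -/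
theorem one_le_of_slit (hδ : 0 < δ) {k : ℤ} (h : 1 / 4 ≤ δ * k) : 1 ≤ k := by
  by_contra hk
  have hk' : (k : ℝ) ≤ 0 := by exact_mod_cast (show k ≤ 0 by omega)
  nlinarith

/-- For `δ < 1/4` a column on the slit is at least `2`. [folklore] -/
theorem two_le_of_slit (hδ : 0 < δ) (hδ4 : δ < 1 / 4) {k : ℤ} (h : 1 / 4 ≤ δ * k) : 2 ≤ k := by
  by_contra hk
  have hk' : (k : ℝ) ≤ 1 := by exact_mod_cast (show k ≤ 1 by omega)
  nlinarith

/-- The slit condition is monotone in the column. [folklore] -/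
theorem slit_mono (hδ : 0 < δ) {k k' : ℤ} (h : 1 / 4 ≤ δ * k') (hk : k' ≤ k) : 1 / 4 ≤ δ * k := by
  have : (k' : ℝ) ≤ k := by exact_mod_cast hk
  nlinarith

/-- The mesh graph of the axis-slit disc is that of the disc (same closure). [folklore] -/
theorem meshGraph_eq (δ : ℝ) : meshGraph (Metric.ball (0 : ℂ) 1 \ {z : ℂ | z.im = 0 ∧ 1 / 4 ≤ z.re}) δ = meshGraph (Metric.ball (0 : ℂ) 1) δ :=
  meshGraph_eq_of_closure_eq closure_domain δ

/-- `ℤ²`-neighbours among the mesh vertices are joined in the mesh vertex graph. [folklore] -/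
theorem vertexGraph_adj (hδ : 0 < δ) {u v : Site 2} (hu : u ∈ meshVertices (Metric.ball (0 : ℂ) 1 \ {z : ℂ | z.im = 0 ∧ 1 / 4 ≤ z.re}) δ)
    (hv : v ∈ meshVertices (Metric.ball (0 : ℂ) 1 \ {z : ℂ | z.im = 0 ∧ 1 / 4 ≤ z.re}) δ) (h : (zdGraph 2).Adj u v) :
    (meshVertexGraph (Metric.ball (0 : ℂ) 1 \ {z : ℂ | z.im = 0 ∧ 1 / 4 ≤ z.re}) δ).Adj ⟨u, hu⟩ ⟨v, hv⟩ := by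
  refine SimpleGraph.induce_adj.2 ?_
  show (meshGraph (Metric.ball (0 : ℂ) 1 \ {z : ℂ | z.im = 0 ∧ 1 / 4 ≤ z.re}) δ).Adj u v
  rw [meshGraph_eq]
  exact UnitDisc.meshGraph_adj_of_zdGraph_adj ((mem_meshVertices_iff hδ).1 hu).1
    ((mem_meshVertices_iff hδ).1 hv).1 h

/-- The origin is a mesh vertex. [folklore] -/
theorem zero_mem_meshVertices (hδ : 0 < δ) : (0 : Site 2) ∈ meshVertices (Metric.ball (0 : ℂ) 1 \ {z : ℂ | z.im = 0 ∧ 1 / 4 ≤ z.re}) δ := by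
  rw [mem_meshVertices_iff hδ]
  refine ⟨UnitDisc.mem_meshVertices_ball.1 (UnitDisc.zero_mem_meshVertices δ), ?_⟩
  rintro ⟨-, h⟩
  norm_num at h

/-- The projection of a mesh vertex to the imaginary axis is a mesh vertex. [folklore] -/
theorem proj_mem (hδ : 0 < δ) {v : Site 2} (hv : v ∈ meshVertices (Metric.ball (0 : ℂ) 1 \ {z : ℂ | z.im = 0 ∧ 1 / 4 ≤ z.re}) δ) :
    (![0, v 1] : Site 2) ∈ meshVertices (Metric.ball (0 : ℂ) 1 \ {z : ℂ | z.im = 0 ∧ 1 / 4 ≤ z.re}) δ := by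
  rw [mem_meshVertices_iff hδ] at hv ⊢
  refine ⟨UnitDisc.norm_meshPoint_lt_one_of_abs_le hv.1 (fun j => by fin_cases j <;> simp), ?_⟩
  rintro ⟨-, h⟩
  norm_num at h

/-- Horizontal phase of the connecting walk: every mesh vertex is joined to its projection on the
imaginary axis (one column at a time towards `0`; all intermediate sites are vertices: their row is
unchanged, and in row `0` the column only decreases in absolute value). [folklore] -/
theorem reachable_proj (hδ : 0 < δ) :
    ∀ (n : ℕ) (v : Site 2) (hv : v ∈ meshVertices (Metric.ball (0 : ℂ) 1 \ {z : ℂ | z.im = 0 ∧ 1 / 4 ≤ z.re}) δ), (v 0).natAbs = n →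
      (meshVertexGraph (Metric.ball (0 : ℂ) 1 \ {z : ℂ | z.im = 0 ∧ 1 / 4 ≤ z.re}) δ).Reachable ⟨v, hv⟩ ⟨![0, v 1], proj_mem hδ hv⟩ := by
  intro n
  induction n with
  | zero =>
    intro v hv hn
    have hv0 : v 0 = 0 := Int.natAbs_eq_zero.1 hn
    have e : (⟨v, hv⟩ : meshVertices (Metric.ball (0 : ℂ) 1 \ {z : ℂ | z.im = 0 ∧ 1 / 4 ≤ z.re}) δ) = ⟨![0, v 1], proj_mem hδ hv⟩ := by
      apply Subtype.ext
      funext i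
      fin_cases i
      · simpa using hv0
      · simp
    rw [e]
  | succ n ih =>
    intro v hv hn
    have hv' := (mem_meshVertices_iff hδ).1 hv
    have hv0 : v 0 ≠ 0 := by
      intro h
      rw [h] at hn
      simp at hn
    obtain ⟨w, hadj, hw0, hw1, hsgn⟩ : ∃ w : Site 2, (zdGraph 2).Adj v w ∧ (w 0).natAbs = n ∧
        w 1 = v 1 ∧ ((0 ≤ w 0 ∧ w 0 < v 0) ∨ (v 0 < w 0 ∧ w 0 ≤ 0)) := by
      rcases lt_or_gt_of_ne hv0 with hneg | hpos
      · refine ⟨v + Pi.single 0 1, (zdGraph_adj_iff _ _).2 ⟨0, Or.inl rfl⟩, ?_, by simp, Or.inr ?_⟩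
        · simp only [Pi.add_apply, Pi.single_eq_same]; omega
        · simp only [Pi.add_apply, Pi.single_eq_same]; omega
      · refine ⟨v - Pi.single 0 1, (zdGraph_adj_iff _ _).2 ⟨0, Or.inr (by simp)⟩, ?_, by simp,
          Or.inl ?_⟩
        · simp only [Pi.sub_apply, Pi.single_eq_same]; omega
        · simp only [Pi.sub_apply, Pi.single_eq_same]; omega
    have habs : ∀ j, |w j| ≤ |v j| := by
      intro j
      fin_cases j
      · show |w 0| ≤ |v 0|
        rcases hsgn with ⟨h1, h2⟩ | ⟨h1, h2⟩
        · rw [abs_of_nonneg h1, abs_of_nonneg (by omega)]; omega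
        · rw [abs_of_nonpos h2, abs_of_nonpos (by omega)]; omega
      · show |w 1| ≤ |v 1|
        rw [hw1]
    have hw : w ∈ meshVertices (Metric.ball (0 : ℂ) 1 \ {z : ℂ | z.im = 0 ∧ 1 / 4 ≤ z.re}) δ := by
      rw [mem_meshVertices_iff hδ]
      refine ⟨UnitDisc.norm_meshPoint_lt_one_of_abs_le hv'.1 habs, ?_⟩
      rintro ⟨hw1', hslit⟩
      apply hv'.2
      refine ⟨by rw [← hw1]; exact hw1', ?_⟩
      have h1 := one_le_of_slit hδ hslit
      rcases hsgn with ⟨-, h2⟩ | ⟨-, h2⟩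
      · exact slit_mono hδ hslit h2.le
      · omega
    have hreach := ih w hw hw0
    have hadj' : (meshVertexGraph (Metric.ball (0 : ℂ) 1 \ {z : ℂ | z.im = 0 ∧ 1 / 4 ≤ z.re}) δ).Adj ⟨v, hv⟩ ⟨w, hw⟩ := vertexGraph_adj hδ hv hw hadj
    have e : (⟨![0, w 1], proj_mem hδ hw⟩ : meshVertices (Metric.ball (0 : ℂ) 1 \ {z : ℂ | z.im = 0 ∧ 1 / 4 ≤ z.re}) δ) = ⟨![0, v 1], proj_mem hδ hv⟩ := by
      apply Subtype.ext
      simp [hw1]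
    rw [← e]
    exact hadj'.reachable.trans hreach

/-- Sites of the imaginary axis below a mesh vertex of the axis are mesh vertices. [folklore] -/
theorem axis_mem (hδ : 0 < δ) {b : ℤ} (hb : (![0, b] : Site 2) ∈ meshVertices (Metric.ball (0 : ℂ) 1 \ {z : ℂ | z.im = 0 ∧ 1 / 4 ≤ z.re}) δ) {b' : ℤ}
    (h : |b'| ≤ |b|) : (![0, b'] : Site 2) ∈ meshVertices (Metric.ball (0 : ℂ) 1 \ {z : ℂ | z.im = 0 ∧ 1 / 4 ≤ z.re}) δ := by
  rw [mem_meshVertices_iff hδ] at hb ⊢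
  refine ⟨UnitDisc.norm_meshPoint_lt_one_of_abs_le hb.1 (fun j => by fin_cases j <;> simp [h]), ?_⟩
  rintro ⟨-, h'⟩
  norm_num at h'

/-- Vertical phase of the connecting walk: the sites of the imaginary axis are joined to `0`.
[folklore] -/
theorem reachable_zero_axis (hδ : 0 < δ) :
    ∀ (n : ℕ) (b : ℤ) (hb : (![0, b] : Site 2) ∈ meshVertices (Metric.ball (0 : ℂ) 1 \ {z : ℂ | z.im = 0 ∧ 1 / 4 ≤ z.re}) δ), b.natAbs = n →
      (meshVertexGraph (Metric.ball (0 : ℂ) 1 \ {z : ℂ | z.im = 0 ∧ 1 / 4 ≤ z.re}) δ).Reachable ⟨![0, b], hb⟩ ⟨0, zero_mem_meshVertices hδ⟩ := by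
  intro n
  induction n with
  | zero =>
    intro b hb hn
    have hb0 : b = 0 := Int.natAbs_eq_zero.1 hn
    subst hb0
    have e : (⟨![0, 0], hb⟩ : meshVertices (Metric.ball (0 : ℂ) 1 \ {z : ℂ | z.im = 0 ∧ 1 / 4 ≤ z.re}) δ) = ⟨0, zero_mem_meshVertices hδ⟩ := by
      apply Subtype.ext
      funext i
      fin_cases i <;> simp
    rw [e]
  | succ n ih =>
    intro b hb hn
    have hb0 : b ≠ 0 := by
      rintro rfl
      simp at hn
    obtain ⟨b', hb'n, hb'abs, hadj⟩ : ∃ b' : ℤ, b'.natAbs = n ∧ |b'| ≤ |b| ∧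
        (zdGraph 2).Adj (![0, b] : Site 2) ![0, b'] := by
      rcases lt_or_gt_of_ne hb0 with hneg | hpos
      · refine ⟨b + 1, by omega, ?_, (zdGraph_adj_iff _ _).2 ⟨1, Or.inl ?_⟩⟩
        · rw [abs_of_nonpos (by omega : b + 1 ≤ 0), abs_of_neg hneg]; omega
        · funext i; fin_cases i <;> simp
      · refine ⟨b - 1, by omega, ?_, (zdGraph_adj_iff _ _).2 ⟨1, Or.inr ?_⟩⟩
        · rw [abs_of_nonneg (by omega : 0 ≤ b - 1), abs_of_pos hpos]; omega
        · funext i; fin_cases i <;> simp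
    have hb' := axis_mem hδ hb hb'abs
    exact (vertexGraph_adj hδ hb hb' hadj).reachable.trans (ih b' hb' hb'n)

/-- Every mesh vertex of the axis-slit disc is joined to the origin. [folklore] -/
theorem reachable_zero (hδ : 0 < δ) (v : Site 2) (hv : v ∈ meshVertices (Metric.ball (0 : ℂ) 1 \ {z : ℂ | z.im = 0 ∧ 1 / 4 ≤ z.re}) δ) :
    (meshVertexGraph (Metric.ball (0 : ℂ) 1 \ {z : ℂ | z.im = 0 ∧ 1 / 4 ≤ z.re}) δ).Reachable ⟨v, hv⟩ ⟨0, zero_mem_meshVertices hδ⟩ :=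
  (reachable_proj hδ _ v hv rfl).trans (reachable_zero_axis hδ _ (v 1) (proj_mem hδ hv) rfl)

/-- The mesh vertex graph of the axis-slit disc is preconnected. [folklore] -/
theorem preconnected (hδ : 0 < δ) : (meshVertexGraph (Metric.ball (0 : ℂ) 1 \ {z : ℂ | z.im = 0 ∧ 1 / 4 ≤ z.re}) δ).Preconnected := fun u v =>
  (reachable_zero hδ u.1 u.2).trans (reachable_zero hδ v.1 v.2).symm

/-- Hence the discrete domain `(Ω_A)_δ` ("the largest component") is the whole vertex set.
[folklore] -/
theorem meshDomain_eq (hδ : 0 < δ) : meshDomain (Metric.ball (0 : ℂ) 1 \ {z : ℂ | z.im = 0 ∧ 1 / 4 ≤ z.re}) δ = meshVertices (Metric.ball (0 : ℂ) 1 \ {z : ℂ | z.im = 0 ∧ 1 / 4 ≤ z.re}) δ := by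
  refine Subset.antisymm (meshDomain_subset_meshVertices _ _) fun v hv => ?_
  have hsub := (preconnected hδ).subsingleton_connectedComponent
  simp only [meshDomain, mem_iUnion, mem_image]
  refine ⟨(meshVertexGraph (Metric.ball (0 : ℂ) 1 \ {z : ℂ | z.im = 0 ∧ 1 / 4 ≤ z.re}) δ).connectedComponentMk ⟨v, hv⟩, fun C' => ?_, ⟨v, hv⟩, ?_, rfl⟩
  · rw [Subsingleton.elim C' ((meshVertexGraph (Metric.ball (0 : ℂ) 1 \ {z : ℂ | z.im = 0 ∧ 1 / 4 ≤ z.re}) δ).connectedComponentMk ⟨v, hv⟩)]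
  · rw [SimpleGraph.ConnectedComponent.mem_supp_iff]

/-- Membership in `(Ω_A)_δ`. [folklore] -/
theorem mem_meshDomain_iff (hδ : 0 < δ) {v : Site 2} :
    v ∈ meshDomain (Metric.ball (0 : ℂ) 1 \ {z : ℂ | z.im = 0 ∧ 1 / 4 ≤ z.re}) δ ↔ v ∈ meshVertices (Metric.ball (0 : ℂ) 1 \ {z : ℂ | z.im = 0 ∧ 1 / 4 ≤ z.re}) δ := by
  rw [meshDomain_eq hδ]

/-- The graph `(Ω_A)_δ` is `ℤ²` restricted to the mesh vertices. [folklore] -/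
theorem adj_iff (hδ : 0 < δ) {u v : Site 2} :
    (discreteDomainGraph (Metric.ball (0 : ℂ) 1 \ {z : ℂ | z.im = 0 ∧ 1 / 4 ≤ z.re}) δ).Adj u v ↔
      (zdGraph 2).Adj u v ∧ u ∈ meshVertices (Metric.ball (0 : ℂ) 1 \ {z : ℂ | z.im = 0 ∧ 1 / 4 ≤ z.re}) δ ∧ v ∈ meshVertices (Metric.ball (0 : ℂ) 1 \ {z : ℂ | z.im = 0 ∧ 1 / 4 ≤ z.re}) δ := by
  rw [Literature.Probability.LatticeModels.discreteDomainGraph_adj_iff, mem_meshDomain_iff hδ,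
    mem_meshDomain_iff hδ]
  constructor
  · rintro ⟨h, hu, hv⟩
    exact ⟨meshGraph_le_zdGraph _ _ h, hu, hv⟩
  · rintro ⟨h, hu, hv⟩
    refine ⟨?_, hu, hv⟩
    rw [meshGraph_eq]
    exact UnitDisc.meshGraph_adj_of_zdGraph_adj ((mem_meshVertices_iff hδ).1 hu).1
      ((mem_meshVertices_iff hδ).1 hv).1 h

/-- **The free sites of the axis-slit disc**: `x ∈ (Ω_A)_δ ∖ ∂(Ω_A)_δ` iff `x` and its four
`ℤ²`-neighbours are mesh vertices. [folklore] -/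
theorem mem_meshInteriorFinset_iff (hδ : 0 < δ) {x : Site 2} :
    x ∈ meshInteriorFinset (Metric.ball (0 : ℂ) 1 \ {z : ℂ | z.im = 0 ∧ 1 / 4 ≤ z.re}) δ ↔
      x ∈ meshVertices (Metric.ball (0 : ℂ) 1 \ {z : ℂ | z.im = 0 ∧ 1 / 4 ≤ z.re}) δ ∧ ∀ y, (zdGraph 2).Adj x y → y ∈ meshVertices (Metric.ball (0 : ℂ) 1 \ {z : ℂ | z.im = 0 ∧ 1 / 4 ≤ z.re}) δ := by
  rw [← Finset.mem_coe, coe_meshInteriorFinset (isBounded_ball.subset Set.sdiff_subset) hδ,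
    Set.mem_sdiff, mem_meshDomain_iff hδ, mem_meshBoundary_iff, mem_meshDomain_iff hδ]
  constructor
  · rintro ⟨hx, hnb⟩
    refine ⟨hx, fun y hy => ?_⟩
    by_contra hy'
    exact hnb ⟨hx, y, hy, fun hadj => hy' ((adj_iff hδ).1 hadj).2.2⟩
  · rintro ⟨hx, hall⟩
    refine ⟨hx, ?_⟩
    rintro ⟨-, y, hy, hnadj⟩
    exact hnadj ((adj_iff hδ).2 ⟨hy, hx, hall y hy⟩)

/-- The free sites of the axis-slit disc are the free sites of the disc none of whose neighbours
(themselves included) lies on the slit. [folklore] -/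
theorem free_iff (hδ : 0 < δ) {x : Site 2} :
    x ∈ meshInteriorFinset (Metric.ball (0 : ℂ) 1 \ {z : ℂ | z.im = 0 ∧ 1 / 4 ≤ z.re}) δ ↔ x ∈ meshInteriorFinset (Metric.ball (0 : ℂ) 1) δ ∧
      ∀ u, (u = x ∨ (zdGraph 2).Adj x u) → ¬ (u 1 = 0 ∧ 1 / 4 ≤ δ * u 0) := by
  rw [mem_meshInteriorFinset_iff hδ, UnitDisc.mem_meshInteriorFinset_iff hδ, mem_meshVertices_iff hδ]
  simp only [mem_meshVertices_iff hδ]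
  constructor
  · rintro ⟨⟨hx1, hx2⟩, hall⟩
    refine ⟨⟨hx1, fun y hy => (hall y hy).1⟩, fun u hu => ?_⟩
    rcases hu with rfl | hu
    · exact hx2
    · exact (hall u hu).2
  · rintro ⟨⟨hx1, hall⟩, hs⟩
    exact ⟨⟨hx1, hs x (Or.inl rfl)⟩, fun y hy => ⟨hall y hy, hs y (Or.inr hy)⟩⟩

/-- Coordinates of a site or of one of its neighbours differ by at most one. [folklore] -/
theorem coord_bounds {x u : Site 2} (hu : u = x ∨ (zdGraph 2).Adj x u) (j : Fin 2) :
    u j ≤ x j + 1 ∧ x j - 1 ≤ u j := by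
  rcases hu with rfl | hu
  · constructor <;> linarith
  · obtain ⟨i, h | h⟩ := (zdGraph_adj_iff _ _).1 hu
    · rw [h]
      by_cases hij : j = i
      · subst hij; simp only [Pi.add_apply, Pi.single_eq_same]; omega
      · simp [hij]
    · have hu' : u = x - Pi.single i 1 := by rw [h]; simp
      rw [hu']
      by_cases hij : j = i
      · subst hij; simp only [Pi.sub_apply, Pi.single_eq_same]; omega
      · simp [hij]

/-- `![v 0, v 1] = v` (local copy of `Percolation.site_eta`, not imported here). [folklore] -/
private theorem vec_eta (v : Site 2) : (![v 0, v 1] : Site 2) = v := by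
  funext i
  fin_cases i <;> rfl

/-- **Free sites are closed under moving the column towards `0`** (for `δ < 1/4`): if `(c, ρ)` is
free and `c'` lies between `0` and `c`, then `(c', ρ)` is free. For the disc part this is the
order-ideal property `UnitDisc.free_of_abs_le`; for the slit part, a slit site among `(c', ρ)` and its
neighbours forces a slit site among `(c, ρ)` and its neighbours, because the slit condition
`ρ = 0 ∧ δ · column ≥ 1/4` is monotone in the column and slit columns are `≥ 2`. [folklore] -/
theorem free_shrink (hδ : 0 < δ) (hδ4 : δ < 1 / 4) {c c' ρ : ℤ}
    (h : (![c, ρ] : Site 2) ∈ meshInteriorFinset (Metric.ball (0 : ℂ) 1 \ {z : ℂ | z.im = 0 ∧ 1 / 4 ≤ z.re}) δ)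
    (hc : (0 ≤ c' ∧ c' ≤ c) ∨ (c ≤ c' ∧ c' ≤ 0)) :
    (![c', ρ] : Site 2) ∈ meshInteriorFinset (Metric.ball (0 : ℂ) 1 \ {z : ℂ | z.im = 0 ∧ 1 / 4 ≤ z.re}) δ := by
  rw [free_iff hδ] at h ⊢
  obtain ⟨hD, hs⟩ := h
  have habs : ∀ j, |(![c', ρ] : Site 2) j| ≤ |(![c, ρ] : Site 2) j| := by
    intro j
    fin_cases j
    · show |c'| ≤ |c|
      rcases hc with ⟨h1, h2⟩ | ⟨h1, h2⟩
      · rw [abs_of_nonneg h1, abs_of_nonneg (h1.trans h2)]; exact h2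
      · rw [abs_of_nonpos h2, abs_of_nonpos (h1.trans h2)]; linarith
    · show |ρ| ≤ |ρ|
      exact le_rfl
  refine ⟨(UnitDisc.mem_meshInteriorFinset_iff hδ).2
    (UnitDisc.free_of_abs_le ((UnitDisc.mem_meshInteriorFinset_iff hδ).1 hD) habs), ?_⟩
  -- the slit part: five cases for `u`
  have hx : ∀ u : Site 2, (u = ![c, ρ] ∨ (zdGraph 2).Adj ![c, ρ] u) → u 1 = 0 →
      1 / 4 ≤ δ * u 0 → False := fun u hu h1 h0 => hs u hu ⟨h1, h0⟩
  intro u hu ⟨hu1, hu0⟩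
  rcases hu with rfl | hu
  · -- `u = (c', ρ)` itself
    simp only [Matrix.cons_val_one, Matrix.cons_val_zero] at hu1 hu0
    have h1 := one_le_of_slit hδ hu0
    have hcc : c' ≤ c := by rcases hc with ⟨-, h2⟩ | ⟨-, h2⟩ <;> omega
    exact hx ![c, ρ] (Or.inl rfl) (by simpa using hu1) (by simpa using slit_mono hδ hu0 hcc)
  · obtain ⟨i, h' | h'⟩ := (zdGraph_adj_iff _ _).1 hu
    · subst h'
      fin_cases i
      · -- `u = (c' + 1, ρ)`
        simp only [Fin.zero_eta, Pi.add_apply, Matrix.cons_val_one, Matrix.cons_val_zero, Pi.single_eq_same, Int.cast_add, Int.cast_one] at hu1 hu0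
        have hu0' : 1 / 4 ≤ δ * ((c' + 1 : ℤ) : ℝ) := by push_cast; exact hu0
        have h2 := two_le_of_slit hδ hδ4 hu0'
        have hρ : ρ = 0 := by simpa using hu1
        rcases lt_or_eq_of_le (show c' ≤ c by rcases hc with ⟨-, h2'⟩ | ⟨-, h2'⟩ <;> omega) with
          hlt | heq
        · exact hx ![c, ρ] (Or.inl rfl) (by simpa using hρ)
            (by simpa using slit_mono hδ hu0' (show c' + 1 ≤ c by omega))
        · subst heq
          exact hx (![c', ρ] + Pi.single 0 1) (Or.inr ((zdGraph_adj_iff _ _).2 ⟨0, Or.inl rfl⟩))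
            (by simpa using hρ) (by simpa using hu0)
      · -- `u = (c', ρ + 1)`
        simp only [Fin.mk_one, Pi.add_apply, Matrix.cons_val_one, Matrix.cons_val_zero, Pi.single_eq_same] at hu1 hu0
        have hu0' : 1 / 4 ≤ δ * (c' : ℝ) := by simpa using hu0
        have h1 := one_le_of_slit hδ hu0'
        have hcc : c' ≤ c := by rcases hc with ⟨-, h2⟩ | ⟨-, h2⟩ <;> omega
        refine hx (![c, ρ] + Pi.single 1 1) (Or.inr ((zdGraph_adj_iff _ _).2 ⟨1, Or.inl rfl⟩))
          (by simpa using hu1) ?_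
        simpa using slit_mono hδ hu0' hcc
    · have hu' : u = ![c', ρ] - Pi.single i 1 := by rw [h']; simp
      subst hu'
      fin_cases i
      · -- `u = (c' - 1, ρ)`
        simp only [Fin.zero_eta, Pi.sub_apply, Matrix.cons_val_one, Matrix.cons_val_zero, Pi.single_eq_same, Int.cast_sub, Int.cast_one] at hu1 hu0
        have hu0' : 1 / 4 ≤ δ * ((c' - 1 : ℤ) : ℝ) := by push_cast; exact hu0
        have h1 := one_le_of_slit hδ hu0'
        have hρ : ρ = 0 := by simpa using hu1
        have hcc : c' ≤ c := by rcases hc with ⟨-, h2⟩ | ⟨-, h2⟩ <;> omega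
        refine hx (![c, ρ] - Pi.single 0 1) (Or.inr ((zdGraph_adj_iff _ _).2 ⟨0, Or.inr (by simp)⟩))
          (by simpa using hρ) ?_
        have := slit_mono hδ hu0' (show c' - 1 ≤ c - 1 by omega)
        simpa using this
      · -- `u = (c', ρ - 1)`
        simp only [Fin.mk_one, Pi.sub_apply, Matrix.cons_val_one, Matrix.cons_val_zero, Pi.single_eq_same] at hu1 hu0
        have hu0' : 1 / 4 ≤ δ * (c' : ℝ) := by simpa using hu0
        have h1 := one_le_of_slit hδ hu0'
        have hcc : c' ≤ c := by rcases hc with ⟨-, h2⟩ | ⟨-, h2⟩ <;> omega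
        refine hx (![c, ρ] - Pi.single 1 1) (Or.inr ((zdGraph_adj_iff _ _).2 ⟨1, Or.inr (by simp)⟩))
          (by simpa using hu1) ?_
        simpa using slit_mono hδ hu0' hcc

/-! ### The polygonal domain of the free sites -/

/-- The free sites of the axis-slit disc are free sites of the disc, so its polygonal domain lies in
the disc polygon. [folklore] -/
theorem polygon_subset_disc_polygon (hδ : 0 < δ) : (meshInteriorPolygon (Metric.ball (0 : ℂ) 1 \ {z : ℂ | z.im = 0 ∧ 1 / 4 ≤ z.re}) δ) ⊆ (meshInteriorPolygon (Metric.ball (0 : ℂ) 1) δ) := by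
  unfold meshInteriorPolygon meshPolygon
  refine interior_mono (Set.biUnion_subset_biUnion_left fun x hx => ?_)
  rw [Finset.mem_coe] at hx ⊢
  exact ((free_iff hδ).1 hx).1

/-- The cells of the free sites lie in the axis-slit disc: they lie in the disc, and a cell meeting
the slit would have its site or its right neighbour on the slit. [folklore] -/
theorem biUnion_meshCell_subset_domain (hδ : 0 < δ) : (⋃ x ∈ ((meshInteriorFinset (Metric.ball (0 : ℂ) 1 \ {z : ℂ | z.im = 0 ∧ 1 / 4 ≤ z.re}) δ : Finset (Site 2)) : Set (Site 2)), meshCell δ x) ⊆ (Metric.ball (0 : ℂ) 1 \ {z : ℂ | z.im = 0 ∧ 1 / 4 ≤ z.re}) := by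
  intro z hz
  simp only [mem_iUnion, Finset.mem_coe, exists_prop] at hz
  obtain ⟨x, hx, hzx⟩ := hz
  obtain ⟨hxD, hxs⟩ := (free_iff hδ).1 hx
  refine ⟨mem_ball_zero_iff.2 (UnitDisc.norm_lt_one_of_mem_meshCell hδ
    ((UnitDisc.mem_meshInteriorFinset_iff hδ).1 hxD) hzx), ?_⟩
  rintro ⟨hzim, hzre⟩
  obtain ⟨hre, him⟩ := mem_meshCell_iff.1 hzx
  rw [hzim, zero_sub, abs_neg, abs_mul, abs_of_pos hδ] at him
  have hx1 : x 1 = 0 := by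
    have h1 : |((x 1 : ℤ) : ℝ)| < 1 := by
      have : |((x 1 : ℤ) : ℝ)| ≤ 1 / 2 := by
        by_contra hcon
        push Not at hcon
        nlinarith
      linarith
    have h2 : |x 1| < 1 := by exact_mod_cast h1
    exact Int.abs_lt_one_iff.1 h2
  -- the right neighbour `x + e₀` is on the slit
  refine hxs (x + Pi.single 0 1) (Or.inr ((zdGraph_adj_iff _ _).2 ⟨0, Or.inl rfl⟩)) ⟨by simp [hx1], ?_⟩
  have hre' := (abs_le.1 hre).2
  simp only [Pi.add_apply, Pi.single_eq_same, Int.cast_add, Int.cast_one]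
  nlinarith

/-- The polygonal domain of the free sites lies in the axis-slit disc. [folklore] -/
theorem polygon_subset_domain (hδ : 0 < δ) : (meshInteriorPolygon (Metric.ball (0 : ℂ) 1 \ {z : ℂ | z.im = 0 ∧ 1 / 4 ≤ z.re}) δ) ⊆ (Metric.ball (0 : ℂ) 1 \ {z : ℂ | z.im = 0 ∧ 1 / 4 ≤ z.re}) := by
  unfold meshInteriorPolygon meshPolygon
  exact interior_subset.trans (biUnion_meshCell_subset_domain hδ)

/-- **Covering lemma.** For `δ > 0`, a point `z` with `‖z‖ + 5δ/2 ≤ 1` which is `5δ/2`-far from the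
slit (`|Im z| > 5δ/2` or `Re z + 5δ/2 < 1/4`) lies in the polygonal domain `P_δ`: the ball `B(z, δ/2)`
is covered by cells of free sites (the cell of the site nearest to `w ∈ B(z, δ/2)`; that site and its
neighbours are within `2δ` of `w`, hence in the disc and off the slit). [folklore] -/
theorem mem_polygon_of_far (hδ : 0 < δ) {z : ℂ} (hz : ‖z‖ + 5 / 2 * δ ≤ 1)
    (hfar : 5 / 2 * δ < |z.im| ∨ z.re + 5 / 2 * δ < 1 / 4) : z ∈ (meshInteriorPolygon (Metric.ball (0 : ℂ) 1 \ {z : ℂ | z.im = 0 ∧ 1 / 4 ≤ z.re}) δ) := by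
  unfold meshInteriorPolygon meshPolygon
  refine mem_interior_iff_mem_nhds.2 (mem_of_superset (ball_mem_nhds z (half_pos hδ)) ?_)
  intro w hw
  rw [mem_ball, dist_eq_norm] at hw
  simp only [mem_iUnion, Finset.mem_coe, exists_prop]
  refine ⟨nearestSite δ w, (free_iff hδ).2 ⟨?_, ?_⟩, mem_meshCell_nearestSite hδ w⟩
  · -- free for the disc (the argument of `UnitDisc.mem_meshInteriorPolygon_of_norm_le`)
    rw [UnitDisc.mem_meshInteriorFinset_iff hδ]
    have hw' : ‖w‖ < ‖z‖ + δ / 2 := by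
      calc ‖w‖ = ‖z + (w - z)‖ := by ring_nf
        _ ≤ ‖z‖ + ‖w - z‖ := norm_add_le _ _
        _ < ‖z‖ + δ / 2 := by linarith
    have hx : ‖meshPoint δ (nearestSite δ w)‖ ≤ ‖w‖ + δ := by
      have hd := dist_meshPoint_nearestSite_le hδ w
      rw [dist_eq_norm] at hd
      calc ‖meshPoint δ (nearestSite δ w)‖ = ‖w + (meshPoint δ (nearestSite δ w) - w)‖ := by ring_nf
        _ ≤ ‖w‖ + ‖meshPoint δ (nearestSite δ w) - w‖ := norm_add_le _ _
        _ ≤ ‖w‖ + δ := by linarith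
    refine ⟨by linarith, fun y hy => ?_⟩
    have hδy := UnitDisc.norm_meshPoint_sub_of_adj δ hy
    rw [abs_of_pos hδ] at hδy
    calc ‖meshPoint δ y‖
        = ‖meshPoint δ (nearestSite δ w) + (meshPoint δ y - meshPoint δ (nearestSite δ w))‖ := by
          ring_nf
      _ ≤ ‖meshPoint δ (nearestSite δ w)‖ + ‖meshPoint δ y - meshPoint δ (nearestSite δ w)‖ :=
          norm_add_le _ _
      _ = ‖meshPoint δ (nearestSite δ w)‖ + δ := by rw [hδy]
      _ < 1 := by linarith
  · -- off the slit
    intro u hu ⟨hu1, hu0⟩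
    have hxw : ‖meshPoint δ (nearestSite δ w) - w‖ ≤ δ := by
      have hd := dist_meshPoint_nearestSite_le hδ w
      rwa [dist_eq_norm] at hd
    have huw : ‖meshPoint δ u - w‖ ≤ 2 * δ := by
      rcases hu with rfl | hu
      · linarith
      · have hδu := UnitDisc.norm_meshPoint_sub_of_adj δ hu
        rw [abs_of_pos hδ] at hδu
        calc ‖meshPoint δ u - w‖
            = ‖(meshPoint δ u - meshPoint δ (nearestSite δ w)) + (meshPoint δ (nearestSite δ w) - w)‖ := by
              ring_nf
          _ ≤ ‖meshPoint δ u - meshPoint δ (nearestSite δ w)‖ + ‖meshPoint δ (nearestSite δ w) - w‖ :=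
              norm_add_le _ _
          _ ≤ δ + δ := add_le_add hδu.le hxw
          _ = 2 * δ := by ring
    have him : |w.im| ≤ 2 * δ := by
      have h := abs_im_le_norm (meshPoint δ u - w)
      rw [Complex.sub_im, meshPoint_im, hu1, Int.cast_zero, mul_zero, zero_sub, abs_neg] at h
      exact h.trans huw
    have hre : 1 / 4 - 2 * δ ≤ w.re := by
      have h := abs_re_le_norm (meshPoint δ u - w)
      rw [Complex.sub_re, meshPoint_re] at h
      have h' := (abs_le.1 (h.trans huw)).2
      linarith
    have hwz_im : |w.im - z.im| < δ / 2 := by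
      have h := abs_im_le_norm (w - z)
      rw [Complex.sub_im] at h
      exact h.trans_lt hw
    have hwz_re : |w.re - z.re| < δ / 2 := by
      have h := abs_re_le_norm (w - z)
      rw [Complex.sub_re] at h
      exact h.trans_lt hw
    rcases hfar with h | h
    · have h1 : |z.im| ≤ |w.im| + |w.im - z.im| := by
        calc |z.im| = |w.im - (w.im - z.im)| := by ring_nf
          _ ≤ |w.im| + |w.im - z.im| := abs_sub _ _
      linarith
    · have h1 := (abs_lt.1 hwz_re).2
      linarith

/-- The origin lies in the polygonal domain for `δ < 1/10`. [folklore] -/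
theorem zero_mem_polygon (hδ : 0 < δ) (hδ1 : δ < 1 / 10) : (0 : ℂ) ∈ (meshInteriorPolygon (Metric.ball (0 : ℂ) 1 \ {z : ℂ | z.im = 0 ∧ 1 / 4 ≤ z.re}) δ) :=
  mem_polygon_of_far hδ (by simp; linarith) (Or.inr (by simp; linarith))

/-- **Locality to the left of the slit**: for `Re z + 2δ < 1/4`, `z` belongs to the polygonal domain of
the axis-slit disc iff it belongs to that of the disc (cells near `z` belong to sites whose neighbours
all have `δ · column < 1/4`). [folklore] -/
theorem mem_polygon_iff_of_re_lt (hδ : 0 < δ) {z : ℂ} (hz : z.re + 2 * δ < 1 / 4) :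
    z ∈ (meshInteriorPolygon (Metric.ball (0 : ℂ) 1 \ {z : ℂ | z.im = 0 ∧ 1 / 4 ≤ z.re}) δ) ↔ z ∈ (meshInteriorPolygon (Metric.ball (0 : ℂ) 1) δ) := by
  refine ⟨fun h => polygon_subset_disc_polygon hδ h, fun h => ?_⟩
  unfold meshInteriorPolygon meshPolygon at h ⊢
  rw [mem_interior_iff_mem_nhds, Metric.mem_nhds_iff] at h ⊢
  obtain ⟨ε, hε, hball⟩ := h
  refine ⟨min ε (δ / 2), lt_min hε (half_pos hδ), fun w hw => ?_⟩
  rw [mem_ball] at hw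
  have hwε : w ∈ ball z ε := mem_ball.2 (hw.trans_le (min_le_left _ _))
  have hwδ : dist w z < δ / 2 := hw.trans_le (min_le_right _ _)
  have hw' := hball hwε
  simp only [mem_iUnion, Finset.mem_coe, exists_prop] at hw' ⊢
  obtain ⟨x, hx, hwx⟩ := hw'
  refine ⟨x, (free_iff hδ).2 ⟨hx, fun u hu ⟨_, hu0⟩ => ?_⟩, hwx⟩
  obtain ⟨hre, -⟩ := mem_meshCell_iff.1 hwx
  have h1 : ((u 0 : ℤ) : ℝ) ≤ (x 0 : ℝ) + 1 := by exact_mod_cast (coord_bounds hu 0).1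
  rw [dist_eq_norm] at hwδ
  have h2 : |(w - z).re| ≤ ‖w - z‖ := abs_re_le_norm _
  rw [Complex.sub_re] at h2
  have h3 := (abs_le.1 hre).1
  have h4 := (abs_lt.1 (h2.trans_lt hwδ)).2
  nlinarith

/-! ### Horizontal sections of the union of cells are intervals -/

/-- Clamped rounding: a real number within half a unit of the integer interval `[c₁, c₂]` is within
`1/2` of an integer of that interval. [folklore] -/
private theorem exists_int_mem_Icc_abs_sub_le {c₁ c₂ : ℤ} {u : ℝ} (h₁ : (c₁ : ℝ) - 1 / 2 ≤ u)
    (h₂ : u ≤ (c₂ : ℝ) + 1 / 2) (h12 : c₁ ≤ c₂) : ∃ m : ℤ, c₁ ≤ m ∧ m ≤ c₂ ∧ |u - m| ≤ 1 / 2 := by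
  have hr := abs_le.1 (abs_sub_round u)
  by_cases hlo : round u < c₁
  · refine ⟨c₁, le_rfl, h12, ?_⟩
    have : (round u : ℝ) + 1 ≤ (c₁ : ℝ) := by exact_mod_cast Int.add_one_le_iff.2 hlo
    rw [abs_le]; constructor <;> linarith [hr.1, hr.2]
  by_cases hhi : c₂ < round u
  · refine ⟨c₂, h12, le_rfl, ?_⟩
    have : (c₂ : ℝ) + 1 ≤ (round u : ℝ) := by exact_mod_cast Int.add_one_le_iff.2 hhi
    rw [abs_le]; constructor <;> linarith [hr.1, hr.2]
  push Not at hlo hhi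
  exact ⟨round u, hlo, hhi, abs_sub_round u⟩

/-- **Horizontal sections of `U_δ` are intervals**: if `(x₁, y)` and `(x₂, y)` lie in the union of
the cells of the free sites and `x₁ ≤ x ≤ x₂`, so does `(x, y)` (for `0 < δ < 1/4`). The cell of the
column of `δℤ` nearest to `x` between the two given columns, in the row of one of the two given cells,
belongs to a free site by `free_shrink` (its column lies between `0` and one of the two given
columns). [folklore] -/
theorem biUnion_mem_of_between (hδ : 0 < δ) (hδ4 : δ < 1 / 4) {x₁ x₂ x y : ℝ}
    (h₁ : (⟨x₁, y⟩ : ℂ) ∈ (⋃ x ∈ ((meshInteriorFinset (Metric.ball (0 : ℂ) 1 \ {z : ℂ | z.im = 0 ∧ 1 / 4 ≤ z.re}) δ : Finset (Site 2)) : Set (Site 2)), meshCell δ x)) (h₂ : (⟨x₂, y⟩ : ℂ) ∈ (⋃ x ∈ ((meshInteriorFinset (Metric.ball (0 : ℂ) 1 \ {z : ℂ | z.im = 0 ∧ 1 / 4 ≤ z.re}) δ : Finset (Site 2)) : Set (Site 2)), meshCell δ x)) (hx₁ : x₁ ≤ x) (hx₂ : x ≤ x₂) :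
    (⟨x, y⟩ : ℂ) ∈ (⋃ x ∈ ((meshInteriorFinset (Metric.ball (0 : ℂ) 1 \ {z : ℂ | z.im = 0 ∧ 1 / 4 ≤ z.re}) δ : Finset (Site 2)) : Set (Site 2)), meshCell δ x) := by
  simp only [mem_iUnion, Finset.mem_coe, exists_prop] at h₁ h₂ ⊢
  obtain ⟨v₁, hv₁, hc₁⟩ := h₁
  obtain ⟨v₂, hv₂, hc₂⟩ := h₂
  obtain ⟨h1re, h1im⟩ := mem_meshCell_iff.1 hc₁
  obtain ⟨h2re, h2im⟩ := mem_meshCell_iff.1 hc₂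
  dsimp only at h1re h1im h2re h2im
  -- the easy cases: `x` in the column of `v₁` or of `v₂`
  by_cases hA : x ≤ δ * v₁ 0 + δ / 2
  · refine ⟨v₁, hv₁, mem_meshCell_iff.2 ⟨?_, h1im⟩⟩
    dsimp only
    rw [abs_le] at h1re ⊢
    constructor <;> linarith [h1re.1]
  by_cases hB : δ * v₂ 0 - δ / 2 ≤ x
  · refine ⟨v₂, hv₂, mem_meshCell_iff.2 ⟨?_, h2im⟩⟩
    dsimp only
    rw [abs_le] at h2re ⊢
    constructor <;> linarith [h2re.2]
  push Not at hA hB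
  -- `δ v₁0 + δ/2 < x < δ v₂0 - δ/2`: a column strictly between
  have hlo : ((v₁ 0 + 1 : ℤ) : ℝ) - 1 / 2 ≤ x / δ := by
    push_cast
    rw [le_div_iff₀ hδ]
    nlinarith
  have hhi : x / δ ≤ ((v₂ 0 - 1 : ℤ) : ℝ) + 1 / 2 := by
    push_cast
    rw [div_le_iff₀ hδ]
    nlinarith
  have h12 : v₁ 0 + 1 ≤ v₂ 0 - 1 := by
    have h' : δ * (((v₁ 0 : ℤ) : ℝ) + 1) < δ * ((v₂ 0 : ℤ) : ℝ) := by nlinarith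
    have h'' : ((v₁ 0 : ℤ) : ℝ) + 1 < ((v₂ 0 : ℤ) : ℝ) := lt_of_mul_lt_mul_left h' hδ.le
    have h3 : v₁ 0 + 1 < v₂ 0 := by exact_mod_cast h''
    omega
  obtain ⟨m, hm1, hm2, hmx⟩ := exists_int_mem_Icc_abs_sub_le hlo hhi h12
  have hmx' : |x - δ * m| ≤ δ / 2 := by
    have : x - δ * m = δ * (x / δ - m) := by rw [mul_sub, mul_div_cancel₀ _ hδ.ne']
    rw [this, abs_mul, abs_of_pos hδ]
    nlinarith
  rcases le_or_gt 0 m with hm0 | hm0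
  · -- `0 ≤ m ≤ v₂ 0`: shrink from `v₂`
    have hv : (![m, v₂ 1] : Site 2) ∈ (meshInteriorFinset (Metric.ball (0 : ℂ) 1 \ {z : ℂ | z.im = 0 ∧ 1 / 4 ≤ z.re}) δ) :=
      free_shrink hδ hδ4 (c := v₂ 0) (by rw [vec_eta]; exact hv₂) (Or.inl ⟨hm0, by omega⟩)
    exact ⟨_, hv, mem_meshCell_iff.2 ⟨by simpa using hmx', by simpa using h2im⟩⟩
  · -- `v₁ 0 ≤ m < 0`: shrink from `v₁`
    have hv : (![m, v₁ 1] : Site 2) ∈ (meshInteriorFinset (Metric.ball (0 : ℂ) 1 \ {z : ℂ | z.im = 0 ∧ 1 / 4 ≤ z.re}) δ) :=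
      free_shrink hδ hδ4 (c := v₁ 0) (by rw [vec_eta]; exact hv₁) (Or.inr ⟨by omega, hm0.le⟩)
    exact ⟨_, hv, mem_meshCell_iff.2 ⟨by simpa using hmx', by simpa using h1im⟩⟩

/-- The points of the imaginary-axis column of a row containing a cell of `U_δ` belong to `U_δ`:
if `z ∈ U_δ` then `(t, Im z) ∈ U_δ` for `|t| ≤ δ/2`. [folklore] -/
theorem axis_column_mem (hδ : 0 < δ) (hδ4 : δ < 1 / 4) {z : ℂ} (hz : z ∈ (⋃ x ∈ ((meshInteriorFinset (Metric.ball (0 : ℂ) 1 \ {z : ℂ | z.im = 0 ∧ 1 / 4 ≤ z.re}) δ : Finset (Site 2)) : Set (Site 2)), meshCell δ x)) {t : ℝ}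
    (ht : |t| ≤ δ / 2) : (⟨t, z.im⟩ : ℂ) ∈ (⋃ x ∈ ((meshInteriorFinset (Metric.ball (0 : ℂ) 1 \ {z : ℂ | z.im = 0 ∧ 1 / 4 ≤ z.re}) δ : Finset (Site 2)) : Set (Site 2)), meshCell δ x) := by
  simp only [mem_iUnion, Finset.mem_coe, exists_prop] at hz ⊢
  obtain ⟨v, hv, hzv⟩ := hz
  obtain ⟨-, him⟩ := mem_meshCell_iff.1 hzv
  have hv0 : (![0, v 1] : Site 2) ∈ (meshInteriorFinset (Metric.ball (0 : ℂ) 1 \ {z : ℂ | z.im = 0 ∧ 1 / 4 ≤ z.re}) δ) := by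
    refine free_shrink hδ hδ4 (c := v 0) (by rw [vec_eta]; exact hv) ?_
    rcases le_or_gt 0 (v 0) with h | h
    · exact Or.inl ⟨le_rfl, h⟩
    · exact Or.inr ⟨h.le, le_rfl⟩
  exact ⟨_, hv0, mem_meshCell_iff.2 ⟨by simpa using ht, by simpa using him⟩⟩

/-- **The polygonal domain is closed under horizontal shrinking**: if `z ∈ P_δ` and `a ∈ [0, 1]` then
`(a · Re z, Im z) ∈ P_δ` (for `0 < δ < 1/4`). A ball `B(z, ε) ⊆ U_δ` with `ε ≤ δ/2` is transported: a
point `w'` of `B((a Re z, Im z), ε)` has abscissa between those of two points of `U_δ` at the same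
height, namely `z + (w' - (a Re z, Im z))` and a point of the imaginary-axis column, so
`biUnion_mem_of_between` applies. [folklore] -/
theorem shrink_mem_polygon (hδ : 0 < δ) (hδ4 : δ < 1 / 4) {z : ℂ} (hz : z ∈ (meshInteriorPolygon (Metric.ball (0 : ℂ) 1 \ {z : ℂ | z.im = 0 ∧ 1 / 4 ≤ z.re}) δ)) {a : ℝ}
    (ha0 : 0 ≤ a) (ha1 : a ≤ 1) : (⟨a * z.re, z.im⟩ : ℂ) ∈ (meshInteriorPolygon (Metric.ball (0 : ℂ) 1 \ {z : ℂ | z.im = 0 ∧ 1 / 4 ≤ z.re}) δ) := by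
  unfold meshInteriorPolygon meshPolygon at hz ⊢
  rw [mem_interior_iff_mem_nhds, Metric.mem_nhds_iff] at hz ⊢
  obtain ⟨ε₀, hε₀, hball⟩ := hz
  have hε : 0 < min ε₀ (δ / 2) := lt_min hε₀ (half_pos hδ)
  have hεδ : min ε₀ (δ / 2) ≤ δ / 2 := min_le_right _ _
  have hball' : ball z (min ε₀ (δ / 2)) ⊆ (⋃ x ∈ ((meshInteriorFinset (Metric.ball (0 : ℂ) 1 \ {z : ℂ | z.im = 0 ∧ 1 / 4 ≤ z.re}) δ : Finset (Site 2)) : Set (Site 2)), meshCell δ x) := (ball_subset_ball (min_le_left _ _)).trans hball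
  refine ⟨min ε₀ (δ / 2), hε, fun w hw => ?_⟩
  rw [mem_ball, dist_eq_norm] at hw
  set d : ℂ := w - ⟨a * z.re, z.im⟩ with hd
  -- two reference points of `U_δ` at height `Im z + Im d`
  have hp : z + d ∈ (⋃ x ∈ ((meshInteriorFinset (Metric.ball (0 : ℂ) 1 \ {z : ℂ | z.im = 0 ∧ 1 / 4 ≤ z.re}) δ : Finset (Site 2)) : Set (Site 2)), meshCell δ x) :=
    hball' (by rw [mem_ball, dist_eq_norm, add_sub_cancel_left]; exact hw)
  have hq : z + (d.im : ℂ) * I ∈ (⋃ x ∈ ((meshInteriorFinset (Metric.ball (0 : ℂ) 1 \ {z : ℂ | z.im = 0 ∧ 1 / 4 ≤ z.re}) δ : Finset (Site 2)) : Set (Site 2)), meshCell δ x) := by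
    refine hball' ?_
    rw [mem_ball, dist_eq_norm, add_sub_cancel_left, norm_mul, Complex.norm_I, mul_one,
      Complex.norm_real, Real.norm_eq_abs]
    exact (abs_im_le_norm d).trans_lt hw
  have hqim : (z + (d.im : ℂ) * I).im = z.im + d.im := by simp
  have haxis : ∀ t : ℝ, |t| ≤ δ / 2 → (⟨t, z.im + d.im⟩ : ℂ) ∈ (⋃ x ∈ ((meshInteriorFinset (Metric.ball (0 : ℂ) 1 \ {z : ℂ | z.im = 0 ∧ 1 / 4 ≤ z.re}) δ : Finset (Site 2)) : Set (Site 2)), meshCell δ x) := fun t ht => by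
    have := axis_column_mem hδ hδ4 hq ht
    rwa [hqim] at this
  have hp' : (⟨z.re + d.re, z.im + d.im⟩ : ℂ) ∈ (⋃ x ∈ ((meshInteriorFinset (Metric.ball (0 : ℂ) 1 \ {z : ℂ | z.im = 0 ∧ 1 / 4 ≤ z.re}) δ : Finset (Site 2)) : Set (Site 2)), meshCell δ x) := by
    convert hp using 1
    apply Complex.ext <;> simp
  have hw_eq : w = ⟨a * z.re + d.re, z.im + d.im⟩ := by
    have : w = ⟨a * z.re, z.im⟩ + d := by rw [hd]; ring
    rw [this]
    apply Complex.ext <;> simp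
  rw [hw_eq]
  have hdre : |d.re| < δ / 2 := (abs_re_le_norm d).trans_lt (hw.trans_le hεδ)
  obtain ⟨hd1, hd2⟩ := abs_lt.1 hdre
  rcases le_or_gt 0 z.re with hzre | hzre
  · refine biUnion_mem_of_between hδ hδ4 (haxis (-(δ / 2)) ?_) hp' ?_ ?_
    · rw [abs_neg, abs_of_pos (half_pos hδ)]
    · nlinarith
    · nlinarith
  · refine biUnion_mem_of_between hδ hδ4 hp' (haxis (δ / 2) ?_) ?_ ?_
    · rw [abs_of_pos (half_pos hδ)]
    · nlinarith
    · nlinarith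

/-- **Vertical shrinking on the imaginary axis**: if `(0, y) ∈ P_δ` and `b ∈ [0, 1]` then
`(0, b y) ∈ P_δ` (for `0 < δ < 1/10`): on the imaginary axis the polygonal domain coincides with that
of the disc (`mem_polygon_iff_of_re_lt`), which is star-shaped about `0`
(`UnitDisc.starConvex_meshInteriorPolygon`). [folklore] -/
theorem axis_shrink_mem_polygon (hδ : 0 < δ) (hδ1 : δ < 1 / 10) {y : ℝ} (hy : (⟨0, y⟩ : ℂ) ∈ (meshInteriorPolygon (Metric.ball (0 : ℂ) 1 \ {z : ℂ | z.im = 0 ∧ 1 / 4 ≤ z.re}) δ))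
    {b : ℝ} (hb0 : 0 ≤ b) (hb1 : b ≤ 1) : (⟨0, b * y⟩ : ℂ) ∈ (meshInteriorPolygon (Metric.ball (0 : ℂ) 1 \ {z : ℂ | z.im = 0 ∧ 1 / 4 ≤ z.re}) δ) := by
  have hD : (⟨0, y⟩ : ℂ) ∈ (meshInteriorPolygon (Metric.ball (0 : ℂ) 1) δ) := polygon_subset_disc_polygon hδ hy
  have hstar := UnitDisc.starConvex_meshInteriorPolygon hδ (by linarith)
  have h' : b • (⟨0, y⟩ : ℂ) ∈ (meshInteriorPolygon (Metric.ball (0 : ℂ) 1) δ) := hstar.smul_mem hD hb0 hb1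
  have heq : b • (⟨0, y⟩ : ℂ) = ⟨0, b * y⟩ := by
    apply Complex.ext <;> simp
  rw [heq] at h'
  exact (mem_polygon_iff_of_re_lt hδ (by show (0 : ℝ) + 2 * δ < 1 / 4; linarith)).2 h'

/-- **A two-stage contraction.** A nonempty subset of `ℂ` closed under horizontal shrinking
`(x, y) ↦ (a x, y)` and, on the imaginary axis, under vertical shrinking `(0, y) ↦ (0, b y)`
(`a, b ∈ [0, 1]`) is contractible (squash onto the imaginary axis, then onto `0`), hence simply
connected. [folklore] -/
theorem isSimplyConnected_of_shrink {s : Set ℂ} (hne : s.Nonempty)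
    (hh : ∀ z ∈ s, ∀ a : ℝ, 0 ≤ a → a ≤ 1 → (⟨a * z.re, z.im⟩ : ℂ) ∈ s)
    (hv : ∀ y : ℝ, (⟨0, y⟩ : ℂ) ∈ s → ∀ b : ℝ, 0 ≤ b → b ≤ 1 → (⟨0, b * y⟩ : ℂ) ∈ s) :
    IsSimplyConnected s := by
  have hax : ∀ z ∈ s, (⟨0, z.im⟩ : ℂ) ∈ s := fun z hz => by
    simpa using hh z hz 0 le_rfl zero_le_one
  obtain ⟨z₀, hz₀⟩ := hne
  have h0 : (0 : ℂ) ∈ s := by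
    have h2 := hv z₀.im (hax z₀ hz₀) 0 le_rfl zero_le_one
    rw [zero_mul] at h2
    exact h2
  have hmem : ∀ (t : ℝ) (z : ℂ), z ∈ s → 0 ≤ t → t ≤ 1 →
      (((max (1 - 2 * t) 0 * z.re : ℝ) : ℂ) + ((min (2 - 2 * t) 1 * z.im : ℝ) : ℂ) * I) ∈ s := by
    intro t z hz ht0 ht1
    rw [← Complex.mk_eq_add_mul_I]
    by_cases ht : t ≤ 1 / 2
    · have hb : min (2 - 2 * t) 1 = 1 := min_eq_right (by linarith)
      rw [hb, one_mul]
      exact hh z hz _ (le_max_right _ _) (max_le (by linarith) zero_le_one)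
    · have ha : max (1 - 2 * t) 0 = 0 := max_eq_right (by linarith)
      rw [ha, zero_mul]
      exact hv z.im (hax z hz) _ (le_min (by linarith) zero_le_one) (min_le_right _ _)
  have : ContractibleSpace s := by
    refine (contractible_iff_id_nullhomotopic s).2 ⟨⟨0, h0⟩, ⟨⟨⟨fun p =>
      ⟨((max (1 - 2 * (p.1 : ℝ)) 0 * (p.2 : ℂ).re : ℝ) : ℂ) +
        ((min (2 - 2 * (p.1 : ℝ)) 1 * (p.2 : ℂ).im : ℝ) : ℂ) * I,
        hmem _ _ p.2.2 p.1.2.1 p.1.2.2⟩, ?_⟩, fun x => ?_, fun x => ?_⟩⟩⟩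
    · refine Continuous.subtype_mk ?_ _
      fun_prop
    · apply Subtype.ext
      simp only [ContinuousMap.id_apply]
      show ((max (1 - 2 * ((0 : unitInterval) : ℝ)) 0 * (x : ℂ).re : ℝ) : ℂ) +
        ((min (2 - 2 * ((0 : unitInterval) : ℝ)) 1 * (x : ℂ).im : ℝ) : ℂ) * I = x
      norm_num [Complex.re_add_im]
    · apply Subtype.ext
      simp only [ContinuousMap.const_apply]
      show ((max (1 - 2 * ((1 : unitInterval) : ℝ)) 0 * (x : ℂ).re : ℝ) : ℂ) +
        ((min (2 - 2 * ((1 : unitInterval) : ℝ)) 1 * (x : ℂ).im : ℝ) : ℂ) * I = 0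
      norm_num
  change SimplyConnectedSpace s
  infer_instance

/-- **The polygonal domain of the discretised axis-slit disc is simply connected** (for
`0 < δ < 1/10`). [folklore] -/
theorem isSimplyConnected_polygon (hδ : 0 < δ) (hδ1 : δ < 1 / 10) : IsSimplyConnected (meshInteriorPolygon (Metric.ball (0 : ℂ) 1 \ {z : ℂ | z.im = 0 ∧ 1 / 4 ≤ z.re}) δ) :=
  isSimplyConnected_of_shrink ⟨0, zero_mem_polygon hδ hδ1⟩
    (fun _ hz _ ha0 ha1 => shrink_mem_polygon hδ (by linarith) hz ha0 ha1)
    (fun _ hy _ hb0 hb1 => axis_shrink_mem_polygon hδ hδ1 hy hb0 hb1)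

/-! ### The boundaries and their Hausdorff distance -/

/-- The boundary of the axis-slit disc is the closed disc minus the axis-slit disc. [folklore] -/
theorem frontier_domain_eq : frontier (Metric.ball (0 : ℂ) 1 \ {z : ℂ | z.im = 0 ∧ 1 / 4 ≤ z.re}) = closedBall (0 : ℂ) 1 \ (Metric.ball (0 : ℂ) 1 \ {z : ℂ | z.im = 0 ∧ 1 / 4 ≤ z.re}) := by
  rw [isOpen_domain.frontier_eq, closure_domain, closure_ball (0 : ℂ) one_ne_zero]

/-- Points of the unit circle are boundary points of the axis-slit disc. [folklore] -/
theorem mem_frontier_of_norm_eq_one {y : ℂ} (hy : ‖y‖ = 1) : y ∈ frontier (Metric.ball (0 : ℂ) 1 \ {z : ℂ | z.im = 0 ∧ 1 / 4 ≤ z.re}) := by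
  rw [frontier_domain_eq, Set.mem_sdiff]
  refine ⟨mem_closedBall_zero_iff.2 hy.le, fun h => ?_⟩
  have := mem_ball_zero_iff.1 h.1
  linarith

/-- Points of the slit in the closed disc are boundary points of the axis-slit disc. [folklore] -/
theorem mem_frontier_of_slit {y : ℂ} (hy : ‖y‖ ≤ 1) (hs : y.im = 0 ∧ 1 / 4 ≤ y.re) :
    y ∈ frontier (Metric.ball (0 : ℂ) 1 \ {z : ℂ | z.im = 0 ∧ 1 / 4 ≤ z.re}) := by
  rw [frontier_domain_eq, Set.mem_sdiff]
  exact ⟨mem_closedBall_zero_iff.2 hy, fun h => h.2 hs⟩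

/-- A boundary point of the axis-slit disc lies on the unit circle or on the slit. [folklore] -/
theorem norm_eq_one_or_slit_of_mem_frontier {y : ℂ} (hy : y ∈ frontier (Metric.ball (0 : ℂ) 1 \ {z : ℂ | z.im = 0 ∧ 1 / 4 ≤ z.re})) :
    ‖y‖ ≤ 1 ∧ (‖y‖ = 1 ∨ (y.im = 0 ∧ 1 / 4 ≤ y.re)) := by
  rw [frontier_domain_eq, Set.mem_sdiff, mem_closedBall_zero_iff] at hy
  obtain ⟨h1, h2⟩ := hy
  refine ⟨h1, ?_⟩
  by_cases hn : ‖y‖ = 1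
  · exact Or.inl hn
  · right
    by_contra hs
    exact h2 ⟨mem_ball_zero_iff.2 (lt_of_le_of_ne h1 hn), hs⟩

/-- The projection `(max (Re z) (1/4), 0)` onto the slit is `2η`-close to a point `z` with
`|Im z| ≤ η` and `Re z + η ≥ 1/4`. [folklore] -/
theorem dist_slitProj_le {z : ℂ} {η : ℝ} (h1 : |z.im| ≤ η) (h2 : 1 / 4 ≤ z.re + η) :
    dist (⟨max z.re (1 / 4), 0⟩ : ℂ) z ≤ 2 * η := by
  rw [dist_eq_norm]
  refine (Complex.norm_le_abs_re_add_abs_im _).trans ?_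
  simp only [Complex.sub_re, Complex.sub_im, zero_sub, abs_neg]
  have hre : |max z.re (1 / 4) - z.re| ≤ η := by
    rw [abs_le]
    constructor
    · linarith [le_max_left z.re (1 / 4), abs_nonneg z.im]
    · rcases le_or_gt (1 / 4) z.re with h | h
      · rw [max_eq_left h]; linarith [abs_nonneg z.im]
      · rw [max_eq_right h.le]; linarith
  linarith

/-- **`∂P_δ` is close to `∂Ω_A`**: every boundary point of the polygonal domain is within `5δ` of the
boundary of the axis-slit disc (for `0 < δ < 1/10`): either it is within `5δ/2` of the unit circle
(radial projection), or it is `5δ/2`-close to the slit (`mem_polygon_of_far`). [folklore] -/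
theorem exists_mem_frontier_dist_le (hδ : 0 < δ) (hδ1 : δ < 1 / 10) {z : ℂ}
    (hz : z ∈ frontier (meshInteriorPolygon (Metric.ball (0 : ℂ) 1 \ {z : ℂ | z.im = 0 ∧ 1 / 4 ≤ z.re}) δ)) : ∃ y ∈ frontier (Metric.ball (0 : ℂ) 1 \ {z : ℂ | z.im = 0 ∧ 1 / 4 ≤ z.re}), dist z y ≤ 5 * δ := by
  have hPo : IsOpen (meshInteriorPolygon (Metric.ball (0 : ℂ) 1 \ {z : ℂ | z.im = 0 ∧ 1 / 4 ≤ z.re}) δ) := isOpen_meshPolygon _ _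
  rw [hPo.frontier_eq] at hz
  obtain ⟨hzc, hzP⟩ := hz
  have hz1 : ‖z‖ < 1 := mem_ball_zero_iff.1 (UnitDisc.closure_meshInteriorPolygon_subset_ball hδ
    (closure_mono (polygon_subset_disc_polygon hδ) hzc))
  by_cases hn : 1 - 5 / 2 * δ < ‖z‖
  · -- radial projection onto the unit circle
    have hz0 : 0 < ‖z‖ := lt_of_le_of_lt (by linarith) hn
    refine ⟨((‖z‖⁻¹ : ℝ) : ℂ) * z, mem_frontier_of_norm_eq_one ?_, ?_⟩
    · rw [norm_mul, Complex.norm_real, Real.norm_eq_abs, abs_of_pos (inv_pos.2 hz0),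
        inv_mul_cancel₀ hz0.ne']
    · rw [dist_eq_norm]
      have : z - ((‖z‖⁻¹ : ℝ) : ℂ) * z = ((1 - ‖z‖⁻¹ : ℝ) : ℂ) * z := by push_cast; ring
      rw [this, norm_mul, Complex.norm_real, Real.norm_eq_abs]
      have h1 : |1 - ‖z‖⁻¹| * ‖z‖ = 1 - ‖z‖ := by
        rw [abs_of_nonpos (by rw [sub_nonpos]; exact one_le_inv_iff₀.2 ⟨hz0, hz1.le⟩), neg_sub,
          sub_mul, inv_mul_cancel₀ hz0.ne', one_mul]
      rw [h1]; linarith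
  · push Not at hn
    -- `z` is `5δ/2`-close to the slit, for otherwise `z ∈ P_δ`
    have hnear : |z.im| ≤ 5 / 2 * δ ∧ 1 / 4 ≤ z.re + 5 / 2 * δ := by
      by_contra hcon
      apply hzP
      apply mem_polygon_of_far hδ (by linarith)
      rcases not_and_or.1 hcon with h | h
      · exact Or.inl (lt_of_not_ge h)
      · exact Or.inr (lt_of_not_ge h)
    refine ⟨⟨max z.re (1 / 4), 0⟩, mem_frontier_of_slit ?_ ⟨rfl, le_max_right _ _⟩, ?_⟩
    · have hre : |z.re| < 1 := (abs_re_le_norm z).trans_lt hz1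
      have hm : |max z.re (1 / 4)| ≤ 1 := by
        rw [abs_le]
        constructor
        · linarith [le_max_right z.re (1 / 4)]
        · exact max_le (le_of_lt (abs_lt.1 hre).2) (by norm_num)
      have : (⟨max z.re (1 / 4), 0⟩ : ℂ) = ((max z.re (1 / 4) : ℝ) : ℂ) := rfl
      rw [this, Complex.norm_real, Real.norm_eq_abs]
      exact hm
    · rw [dist_comm]
      have := dist_slitProj_le hnear.1 hnear.2
      linarith

/-- **`∂Ω_A` is close to `P_δ`**: every boundary point of the axis-slit disc is within `9δ` of a
point of the polygonal domain (for `0 < δ < 1/50`): explicit interior points `5δ/2`-far from the slit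
and `5δ/2`-deep in the disc (`mem_polygon_of_far`). [folklore] -/
theorem exists_mem_polygon_dist_le (hδ : 0 < δ) (hδ1 : δ < 1 / 50) {y : ℂ} (hy : y ∈ frontier (Metric.ball (0 : ℂ) 1 \ {z : ℂ | z.im = 0 ∧ 1 / 4 ≤ z.re})) :
    ∃ p ∈ (meshInteriorPolygon (Metric.ball (0 : ℂ) 1 \ {z : ℂ | z.im = 0 ∧ 1 / 4 ≤ z.re}) δ), dist p y ≤ 9 * δ := by
  obtain ⟨hy1, hcase⟩ := norm_eq_one_or_slit_of_mem_frontier hy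
  rcases hcase with hs | ⟨him, hre⟩
  · -- `y` on the unit circle
    have hshrink : ‖((1 - 5 * δ : ℝ) : ℂ) * y‖ + 5 / 2 * δ ≤ 1 := by
      rw [norm_mul, Complex.norm_real, Real.norm_eq_abs, abs_of_pos (by linarith), hs]; linarith
    have hdist : dist (((1 - 5 * δ : ℝ) : ℂ) * y) y ≤ 9 * δ := by
      rw [dist_eq_norm]
      have : ((1 - 5 * δ : ℝ) : ℂ) * y - y = ((-(5 * δ) : ℝ) : ℂ) * y := by push_cast; ring
      rw [this, norm_mul, Complex.norm_real, Real.norm_eq_abs, abs_neg, abs_of_pos (by positivity),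
        hs]
      linarith
    by_cases h1 : 1 / 2 ≤ |y.im|
    · -- away from the real axis: shrink radially
      refine ⟨((1 - 5 * δ : ℝ) : ℂ) * y, mem_polygon_of_far hδ hshrink (Or.inl ?_), hdist⟩
      rw [Complex.im_ofReal_mul, abs_mul, abs_of_pos (by linarith)]
      nlinarith
    · push Not at h1
      have hre2 : 1 / 4 < y.re ^ 2 := by
        have hn : y.re ^ 2 + y.im ^ 2 = 1 := by
          have := Complex.sq_norm y
          rw [hs, Complex.normSq_apply] at this
          nlinarith [this]
        nlinarith [abs_nonneg y.im, sq_abs y.im]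
      by_cases h2 : y.re < 0
      · -- near `-1`: shrink radially, the real part stays negative
        refine ⟨((1 - 5 * δ : ℝ) : ℂ) * y, mem_polygon_of_far hδ hshrink (Or.inr ?_), hdist⟩
        rw [Complex.re_ofReal_mul]
        nlinarith
      · -- near `1`: shrink radially and turn away from the real axis
        push Not at h2
        have hyre : 1 / 2 < y.re := by nlinarith
        set σ : ℝ := if 0 ≤ y.im then 1 else -1 with hσ
        have hσ1 : σ * σ = 1 := by rw [hσ]; split_ifs <;> norm_num
        have hσim : 0 ≤ σ * y.im := by
          rw [hσ]; split_ifs with h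
          · linarith
          · push Not at h; nlinarith
        set c : ℂ := ((1 - 5 * δ : ℝ) : ℂ) + ((6 * δ * σ : ℝ) : ℂ) * I with hc
        have hcnorm : ‖c‖ ^ 2 = (1 - 5 * δ) ^ 2 + (6 * δ) ^ 2 := by
          rw [Complex.sq_norm, hc, Complex.normSq_apply]
          simp only [Complex.add_re, Complex.ofReal_re, Complex.mul_re, Complex.I_re, mul_zero,
            Complex.ofReal_im, Complex.I_im, mul_one, sub_self, add_zero, Complex.add_im,
            Complex.mul_im, zero_add]
          nlinarith [hσ1]
        have hcle : ‖c‖ ≤ 1 - 5 / 2 * δ := by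
          have h0 : 0 ≤ 1 - 5 / 2 * δ := by linarith
          nlinarith [norm_nonneg c, hcnorm]
        have hc1 : ‖c - 1‖ ≤ 8 * δ := by
          have hsq : ‖c - 1‖ ^ 2 = (5 * δ) ^ 2 + (6 * δ) ^ 2 := by
            rw [Complex.sq_norm, hc, Complex.normSq_apply]
            simp only [Complex.sub_re, Complex.add_re, Complex.ofReal_re, Complex.mul_re, Complex.I_re,
              mul_zero, Complex.ofReal_im, Complex.I_im, mul_one, sub_self, add_zero, Complex.one_re,
              Complex.sub_im, Complex.add_im, Complex.mul_im, zero_add, Complex.one_im, sub_zero]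
            nlinarith [hσ1]
          nlinarith [norm_nonneg (c - 1), hδ]
        refine ⟨c * y, mem_polygon_of_far hδ ?_ (Or.inl ?_), ?_⟩
        · rw [norm_mul, hs, mul_one]; linarith
        · -- `|Im (c y)| = (1 - 5δ)|Im y| + 6δ Re y ≥ 3δ`
          have him : (c * y).im = (1 - 5 * δ) * y.im + 6 * δ * σ * y.re := by
            rw [hc]; simp only [Complex.mul_im, Complex.add_re, Complex.ofReal_re, Complex.mul_re,
              Complex.I_re, mul_zero, Complex.ofReal_im, Complex.I_im, mul_one, sub_self, add_zero,
              Complex.add_im, Complex.mul_im, zero_add]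
          have key : 3 * δ ≤ σ * (c * y).im := by
            rw [him]
            have : σ * ((1 - 5 * δ) * y.im + 6 * δ * σ * y.re) =
                (1 - 5 * δ) * (σ * y.im) + 6 * δ * (σ * σ) * y.re := by ring
            rw [this, hσ1]
            nlinarith
          have hσabs : |σ| = 1 := by rw [hσ]; split_ifs <;> norm_num
          calc 5 / 2 * δ < 3 * δ := by linarith
            _ ≤ σ * (c * y).im := key
            _ ≤ |σ * (c * y).im| := le_abs_self _
            _ = |(c * y).im| := by rw [abs_mul, hσabs, one_mul]
        · rw [dist_eq_norm, show c * y - y = (c - 1) * y by ring, norm_mul, hs, mul_one]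
          linarith
  · -- `y` on the slit: `y = (t, 0)`, `1/4 ≤ t ≤ 1`
    have ht1 : y.re ≤ 1 := (abs_re_le_norm y).trans hy1 |> fun h => (abs_le.1 h).2
    set m : ℝ := min y.re (1 - 6 * δ) with hm
    have hm0 : 0 ≤ m := le_min (by linarith) (by linarith)
    have hm1 : m ≤ 1 - 6 * δ := min_le_right _ _
    refine ⟨⟨m, 3 * δ⟩, mem_polygon_of_far hδ ?_ (Or.inl ?_), ?_⟩
    · -- `‖(m, 3δ)‖ ≤ 1 - 5δ/2`
      have hsq : ‖(⟨m, 3 * δ⟩ : ℂ)‖ ^ 2 = m ^ 2 + (3 * δ) ^ 2 := by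
        rw [Complex.sq_norm, Complex.normSq_apply]; ring
      have h0 : 0 ≤ 1 - 5 / 2 * δ := by linarith
      nlinarith [norm_nonneg (⟨m, 3 * δ⟩ : ℂ)]
    · show 5 / 2 * δ < |3 * δ|
      rw [abs_of_pos (by positivity)]; linarith
    · rw [dist_eq_norm]
      refine (Complex.norm_le_abs_re_add_abs_im _).trans ?_
      simp only [Complex.sub_re, Complex.sub_im, him, sub_zero]
      rw [abs_of_pos (by positivity : (0 : ℝ) < 3 * δ)]
      have : |m - y.re| ≤ 6 * δ := by
        rw [abs_le]; constructor
        · rcases le_or_gt y.re (1 - 6 * δ) with h | h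
          · rw [hm, min_eq_left h]; linarith
          · rw [hm, min_eq_right h.le]; linarith
        · linarith [min_le_left y.re (1 - 6 * δ)]
      linarith

/-- A point of a segment is no farther from an endpoint than the other endpoint. [folklore] -/
private theorem dist_le_of_mem_segment {p q y : ℂ} (h : q ∈ segment ℝ p y) : dist q y ≤ dist p y := by
  have := dist_add_dist_of_mem_segment h
  linarith [dist_nonneg (x := p) (y := q)]

/-- **Hausdorff control of the discrete boundary**: for `0 < δ < 1/50`,
`hausdorffDist (∂P_δ) (∂Ω_A) ≤ 9δ`. From `∂P_δ` use `exists_mem_frontier_dist_le`; from a point `y` of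
`∂Ω_A`, the segment from the interior point of `exists_mem_polygon_dist_le` to `y ∉ P_δ` meets `∂P_δ`
within `9δ` of `y`. [folklore] -/
theorem hausdorffDist_frontier_le (hδ : 0 < δ) (hδ1 : δ < 1 / 50) :
    hausdorffDist (frontier (meshInteriorPolygon (Metric.ball (0 : ℂ) 1 \ {z : ℂ | z.im = 0 ∧ 1 / 4 ≤ z.re}) δ)) (frontier (Metric.ball (0 : ℂ) 1 \ {z : ℂ | z.im = 0 ∧ 1 / 4 ≤ z.re})) ≤ 9 * δ := by
  have hPo : IsOpen (meshInteriorPolygon (Metric.ball (0 : ℂ) 1 \ {z : ℂ | z.im = 0 ∧ 1 / 4 ≤ z.re}) δ) := isOpen_meshPolygon _ _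
  refine hausdorffDist_le_of_mem_dist (by positivity) (fun z hz => ?_) (fun y hy => ?_)
  · obtain ⟨y, hy, hd⟩ := exists_mem_frontier_dist_le hδ (by linarith) hz
    exact ⟨y, hy, hd.trans (by linarith)⟩
  · obtain ⟨p, hp, hpd⟩ := exists_mem_polygon_dist_le hδ hδ1 hy
    have hyP : y ∉ (meshInteriorPolygon (Metric.ball (0 : ℂ) 1 \ {z : ℂ | z.im = 0 ∧ 1 / 4 ≤ z.re}) δ) := fun h => by
      rw [frontier_domain_eq, Set.mem_sdiff] at hy
      exact hy.2 (polygon_subset_domain hδ h)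
    have hS : IsPreconnected (segment ℝ p y) := (convex_segment p y).isPreconnected
    have hnot : ¬ (closure (meshInteriorPolygon (Metric.ball (0 : ℂ) 1 \ {z : ℂ | z.im = 0 ∧ 1 / 4 ≤ z.re}) δ) ∩ segment ℝ p y ⊆ (meshInteriorPolygon (Metric.ball (0 : ℂ) 1 \ {z : ℂ | z.im = 0 ∧ 1 / 4 ≤ z.re}) δ)) := fun h =>
      hyP (hS.subset_of_closure_inter_subset hPo ⟨p, left_mem_segment ℝ p y, hp⟩ h
        (right_mem_segment ℝ p y))
    obtain ⟨q, ⟨hqc, hqS⟩, hqP⟩ := not_subset.1 hnot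
    have hqf : q ∈ frontier (meshInteriorPolygon (Metric.ball (0 : ℂ) 1 \ {z : ℂ | z.im = 0 ∧ 1 / 4 ≤ z.re}) δ) := by rw [hPo.frontier_eq]; exact ⟨hqc, hqP⟩
    refine ⟨q, hqf, ?_⟩
    calc dist y q = dist q y := dist_comm _ _
      _ ≤ dist p y := dist_le_of_mem_segment hqS
      _ ≤ 9 * δ := hpd

/-- **Compact exhaustion**: every compact `K ⊆ Ω_A` lies in `P_δ` for all small `δ > 0`. [folklore] -/
theorem eventually_subset_polygon {K : Set ℂ} (hK : IsCompact K) (hKΩ : K ⊆ (Metric.ball (0 : ℂ) 1 \ {z : ℂ | z.im = 0 ∧ 1 / 4 ≤ z.re})) :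
    ∀ᶠ δ in 𝓝[>] (0 : ℝ), K ⊆ meshInteriorPolygon (Metric.ball (0 : ℂ) 1 \ {z : ℂ | z.im = 0 ∧ 1 / 4 ≤ z.re}) δ := by
  obtain ⟨r, hr1, hKr⟩ := exists_lt_subset_ball hK.isClosed (hKΩ.trans Set.sdiff_subset)
  obtain ⟨ε, hε, hthick⟩ := hK.exists_cthickening_subset_open isOpen_domain hKΩ
  have hI : Ioo (0 : ℝ) (min (2 / 5 * (1 - r)) (ε / 5)) ∈ 𝓝[>] (0 : ℝ) :=
    Ioo_mem_nhdsGT (lt_min (by linarith) (by positivity))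
  filter_upwards [hI] with δ hδ z hz
  have hδ0 := hδ.1
  have hδr : δ < 2 / 5 * (1 - r) := hδ.2.trans_le (min_le_left _ _)
  have hδε : δ < ε / 5 := hδ.2.trans_le (min_le_right _ _)
  have hz' : ‖z‖ < r := mem_ball_zero_iff.1 (hKr hz)
  refine mem_polygon_of_far hδ0 (by linarith) ?_
  by_contra hcon
  obtain ⟨h1, h2⟩ := not_or.1 hcon
  have h1' : |z.im| ≤ 5 / 2 * δ := not_lt.1 h1
  have h2' : 1 / 4 ≤ z.re + 5 / 2 * δ := not_lt.1 h2
  have hp : (⟨max z.re (1 / 4), 0⟩ : ℂ) ∈ (Metric.ball (0 : ℂ) 1 \ {z : ℂ | z.im = 0 ∧ 1 / 4 ≤ z.re}) := by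
    refine hthick (mem_cthickening_of_dist_le _ z ε K hz ?_)
    have := dist_slitProj_le h1' h2'
    linarith
  exact hp.2 ⟨rfl, le_max_right _ _⟩

/-! ### `MeshApproximates` for the axis-slit disc, and the refutation of `tendsto_chiPlusCorr` -/

/-- **The discretised axis-slit disc approximates the axis-slit disc in CHI's sense**
(`MeshApproximates`, arXiv:1202.2838 §2.1 and §2.6): eventually the polygonal domain `P_δ` of the
free sites is simply connected, `hausdorffDist (∂P_δ) (∂Ω_A) ≤ 9δ → 0`, and every compact subset of
`Ω_A` is eventually inside `P_δ`. (The axis slit carries mesh points of every lattice `δℤ²`, in contrast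
with the irrational-slope slit of `PlanarIsingSlitDisc.lean`.) [folklore] -/
theorem meshApproximates_domain : MeshApproximates (Metric.ball (0 : ℂ) 1 \ {z : ℂ | z.im = 0 ∧ 1 / 4 ≤ z.re}) := by
  have hI : Ioo (0 : ℝ) (1 / 50) ∈ 𝓝[>] (0 : ℝ) := Ioo_mem_nhdsGT (by norm_num)
  refine ⟨?_, ?_, fun K hK hKΩ => eventually_subset_polygon hK hKΩ⟩
  · filter_upwards [hI] with δ hδ
    exact isSimplyConnected_polygon hδ.1 (by linarith [hδ.2])
  · have hg : Tendsto (fun δ : ℝ => 9 * δ) (𝓝[>] 0) (𝓝 0) := by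
      have : Tendsto (fun δ : ℝ => 9 * δ) (𝓝 0) (𝓝 (9 * 0)) := tendsto_const_nhds.mul tendsto_id
      rw [mul_zero] at this
      exact this.mono_left nhdsWithin_le_nhds
    refine squeeze_zero' (Eventually.of_forall fun δ => hausdorffDist_nonneg) ?_ hg
    filter_upwards [hI] with δ hδ
    exact hausdorffDist_frontier_le hδ.1 hδ.2

/-- **`tendsto_chiPlusCorr` is refuted relative to CHI Thm 1.3 (`k = 0`) and Wu's asymptotics.**
Under the named facts `chi_onePoint_rho` (Chelkak–Hongler–Izyurov, Ann. Math. 181 (2015) =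
arXiv:1202.2838, Thm 1.3 with `k = 0` and eqs. (1.2)–(1.3), for discretisations approximating the
domain) and `wu_rhoCHI` (CHI Rem. 1.2 (iii), after Wu), the tree's transcription
`Literature.Probability.LatticeModels.tendsto_chiPlusCorr` of CHI Thm 1.1 — existence of the limit of
`δ^{-n/8} 𝔼⁺_{Ω_δ}[σ_{a₁}⋯σ_{aₙ}]` for **every** admissible `Ω` on the **fixed** scheme
`Ω_δ = meshDomain Ω δ`, without CHI's hypothesis that `Ω_δ` approximate `Ω` (§1.1, §2.6) — is false:
by `not_tendsto_chiPlusCorr_of_meshApproximates` (rational-height slit: the translate `i/2 + Ω_A` of the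
axis-slit disc is discretised like `i/2 + 𝔻` at odd meshes and like `Ω_A` at even meshes, whose CHI
limits `𝒦` and `𝒦 (25/16)^{1/8}` differ) and `meshApproximates_domain`. The corrected statement is
`tendsto_chiPlusCorr_of_hausdorff` (`PlanarIsingOnePoint.lean`). [cite: ChelkakHonglerIzyurovAnnals2015, Thm. 1.1 and Thm. 1.3 (k = 0) with eqs. (1.2)–(1.3), Rem. 1.2 (iii); §1.1, §2.6 (approximation hypothesis)] -/
theorem not_tendsto_chiPlusCorr_of_chi (h₁ : chi_onePoint_rho) (h₂ : wu_rhoCHI) :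
    ¬ tendsto_chiPlusCorr :=
  not_tendsto_chiPlusCorr_of_meshApproximates meshApproximates_domain h₁ h₂

/-- The same refutation from the corrected one-point fact in its packaged form: the hypotheses of
`not_tendsto_chiPlusCorr_of_chi` are exactly those from which `chi_halfplane_onePoint_hausdorff` is
derived in `PlanarIsingOnePoint.lean`; recorded for cross-reference. [folklore] -/
theorem not_tendsto_chiPlusCorr_and_halfplane_of_chi (h₁ : chi_onePoint_rho) (h₂ : wu_rhoCHI) :
    ¬ tendsto_chiPlusCorr ∧ chi_halfplane_onePoint_hausdorff :=
  ⟨not_tendsto_chiPlusCorr_of_chi h₁ h₂, chi_halfplane_onePoint_hausdorff_of h₁ h₂⟩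


end AxisSlitDisc

end Literature.Probability.LatticeModels
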